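import Mathlib
import Literature.NumberTheory.LFunctions.WeilExplicit
import Literature.NumberTheory.LFunctions.WeilGroundState
import Literature.NumberTheory.LFunctions.RiemannXi
import Literature.NumberTheory.LFunctions.RiemannXiFourier
import Summits.RiemannHypothesis.RiemannHypothesis.Theses.WeilGroundState

/-!
Scratch for crux-ideate stmt-RiemannHypothesis-1527 (GroundStatesConvergeToXi), ideator 1, round 1.
First lemmas of the two idea cards, stated over existing declarations (not proved here).
-/

noncomputable section

open Complex Filter Set MeasureTheory
open scoped Real Topology ArithmeticFunction.vonMangoldt ComplexConjugate

namespace Summit.RiemannHypothesis.RiemannHypothesis.Cruxes.GroundStatesConvergeToXi.Ideator1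

open Literature.NumberTheory.LFunctions

/-! ## Card `harmonic-weak-limit-closure` — first lemma

RH-free CLOSURE LEMMA: a nonzero weak limit (in the weighted space `L²(e^{(1+δ)|t|} dt)`) of
renormalised Weil ground states on windows `a_k → ∞` is annihilated by the explicit formula at EVERY
nontrivial zero of `ζ` (on or off the line), and the ground energies tend to `0`. -/

/-- Weak convergence of `v_k` to `φ` tested against Weil test functions. -/
def WeakTestLimit (v : ℕ → ℝ → ℂ) (φ : ℝ → ℂ) : Prop :=
  ∀ g : ℝ → ℂ, IsWeilTest g →
    Tendsto (fun k => ∫ t, v k t * conj (g t)) atTop (𝓝 (∫ t, φ t * conj (g t)))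

/-- FIRST LEMMA (card 1). Let `u_k` be ground states at windows `a_k → ∞`, `c_k` scalars such that
`c_k u_k` is bounded in `L²(e^{(1+δ)|t|}dt)` and converges weakly (against test functions) to `φ`
with `φ` in the same weighted space and `φ ≠ 0`. Then `ε(a_k) → 0` and `φ̂(ρ) = weilMellin φ ρ = 0`
for every nontrivial zero `ρ` of `ζ` — with NO hypothesis on the location of the zeros. -/
def HarmonicWeakLimitClosure : Prop :=
  ∀ δ : ℝ, 0 < δ → ∀ (a : ℕ → ℝ) (u : ℕ → ℝ → ℂ) (c : ℕ → ℂ) (φ : ℝ → ℂ),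
    Tendsto a atTop atTop →
    (∀ k, IsWeilGroundState (a k) (u k)) →
    AEStronglyMeasurable φ volume →
    Integrable (fun t => ‖φ t‖ ^ 2 * Real.exp ((1 + δ) * |t|)) →
    (∃ C : ℝ, ∀ k, ∫ t, ‖c k * u k t‖ ^ 2 * Real.exp ((1 + δ) * |t|) ≤ C) →
    WeakTestLimit (fun k t => c k * u k t) φ →
    ¬ (φ =ᵐ[volume] 0) →
      Tendsto (fun k => weilGroundEnergy (a k)) atTop (𝓝 0) ∧
      ∀ ρ : ℂ, riemannZeta ρ = 0 → 0 < ρ.re → ρ.re < 1 → weilMellin φ ρ = 0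

/-- Companion (same hypotheses, pure complex analysis): weak weighted convergence upgrades to locally
uniform convergence of the transforms on the open critical strip, towards `weilMellin φ`. This is the
shape the route's Hurwitz glue consumes. -/
def WeakLimitMellinLocallyUniform : Prop :=
  ∀ δ : ℝ, 0 < δ → ∀ (u : ℕ → ℝ → ℂ) (c : ℕ → ℂ) (φ : ℝ → ℂ) (a : ℕ → ℝ),
    (∀ k, IsWeilGroundState (a k) (u k)) →
    AEStronglyMeasurable φ volume →
    Integrable (fun t => ‖φ t‖ ^ 2 * Real.exp ((1 + δ) * |t|)) →
    (∃ C : ℝ, ∀ k, ∫ t, ‖c k * u k t‖ ^ 2 * Real.exp ((1 + δ) * |t|) ≤ C) →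
    WeakTestLimit (fun k t => c k * u k t) φ →
      TendstoLocallyUniformlyOn (fun k s => c k * weilMellin (u k) s) (weilMellin φ) atTop
        {s : ℂ | 0 < s.re ∧ s.re < 1}

/-- How the two lemmas decide the sub-problem WITHOUT identifying the limit as `ξ` (note for the
tenure planner; not an item): nonzero weak limit + C–vS real zeros + Hurwitz ⇒ RH. Stated as a Prop
over the route's own decls. -/
def TightnessSufficesForAssembly : Prop :=
  Theses.WeilGroundState.GroundStateSimpleEven →
  Theses.WeilGroundState.GroundStateMellinRealZeros →
  HarmonicWeakLimitClosure → WeakLimitMellinLocallyUniform →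
  (∃ δ : ℝ, 0 < δ ∧ ∃ (a : ℕ → ℝ) (u : ℕ → ℝ → ℂ) (c : ℕ → ℂ) (φ : ℝ → ℂ),
    Tendsto a atTop atTop ∧ (∀ k, IsWeilGroundState (a k) (u k)) ∧
    AEStronglyMeasurable φ volume ∧
    Integrable (fun t => ‖φ t‖ ^ 2 * Real.exp ((1 + δ) * |t|)) ∧
    (∃ C : ℝ, ∀ k, ∫ t, ‖c k * u k t‖ ^ 2 * Real.exp ((1 + δ) * |t|) ≤ C) ∧
    WeakTestLimit (fun k t => c k * u k t) φ ∧ ¬ (φ =ᵐ[volume] 0)) →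
  _root_.RiemannHypothesis

/-! ## Card `xi-kernel-doob-transform` — first lemma

Riemann's kernel `Φ(t) = 2Ψ(2t)` (`LagariasMontague.Psi` in the tree; `ξ(1/2+it) = ∫ Φ(τ)e^{itτ}dτ`,
i.e. `weilMellin Φ = riemannXi`) is annihilated by the full-line Weil operator UNCONDITIONALLY
(`ξ(ρ) = 0` at every nontrivial zero), and conjugating Weil's quadratic form by it turns the form into
a pure SIGNED JUMP FORM in `w = g/Φ` (ground-state / Doob transform): no killing constant, no pole form. -/

/-- Riemann's kernel in the tree's additive normalisation: `Φ(t) := 2 Ψ(2t)`. -/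
def xiKernel (t : ℝ) : ℝ := 2 * LagariasMontague.Psi (2 * t)

/-- `Φ̂ = ξ`: the Mellin–Laplace transform of `Φ` in the Weil normalisation is Riemann's `ξ`
(critical line: `riemannXi_criticalLine_eq_fourier`; everywhere by analytic continuation). -/
def xiKernel_weilMellin : Prop :=
  ∀ s : ℂ, weilMellin (fun t => (xiKernel t : ℂ)) s = riemannXi s

/-- `Φ` is Weil-harmonic, unconditionally: `W(Φ ⋆ g̃) = 0` for every test `g`
(explicit formula for the rapidly decaying function `Φ ⋆ g̃`, whose transform `ξ(s)·(g̃)^(s)`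
vanishes at every nontrivial zero, real part `1/2` or not). -/
def xiKernel_weilHarmonic : Prop :=
  ∀ g : ℝ → ℂ, IsWeilTest g →
    weilFunctional (weilConv (fun t => (xiKernel t : ℂ)) (weilReflect g)) = 0

/-- The `Φ`-weighted jump energy at lag `h`: `I_w(h) = ∫ Φ(t)Φ(t+h) |w(t+h) − w(t)|² dt`. -/
def xiJumpEnergy (w : ℝ → ℂ) (h : ℝ) : ℝ :=
  ∫ t, xiKernel t * xiKernel (t + h) * ‖w (t + h) - w t‖ ^ 2

/-- FIRST LEMMA (card 2) — the DOOB / ground-state-transform IDENTITY (RH-free): for every test `w`,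
`Q(Φ·w) = Σ_n Λ(n) n^{-1/2} I_w(log n) + ∫₀^∞ e^{h/2}/(2 sinh h) I_w(h) dh − ∫₀^∞ 2 cosh(h/2) I_w(h) dh`,
i.e. Weil's form conjugated by `Φ` is the jump form of the signed Lévy kernel
`J = (prime-power atoms Λ(n)/√n at ±log n) + e^{|h|/2}/(2 sinh|h|) − 2 cosh(h/2)`
weighted by `Φ ⊗ Φ` — the killing constant and the rank-2 polar form are absorbed exactly by `LΦ = 0`. -/
def DoobIdentity : Prop :=
  ∀ w : ℝ → ℂ, IsWeilTest w →
    (weilQuadratic (fun t => (xiKernel t : ℂ) * w t)).re =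
      (∑' n : ℕ, (Λ n : ℝ) / Real.sqrt n * xiJumpEnergy w (Real.log n))
        + (∫ h in Ioi (0 : ℝ), Real.exp (h / 2) / (2 * Real.sinh h) * xiJumpEnergy w h)
        - (∫ h in Ioi (0 : ℝ), 2 * Real.cosh (h / 2) * xiJumpEnergy w h)

/-- TRANSFER target shared by both cards (C⁺ ⇒ crux): weighted-`L²` convergence of renormalised
ground states to Riemann's kernel. `C⁺ → GroundStatesConvergeToXi` is bookkeeping
(`|û(s) − ξ(s)| ≤ ∫ |c u − Φ| e^{|Re s − 1/2||t|} dt` and `xiKernel_weilMellin`). -/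
def GroundStatesConvergeToXiKernel : Prop :=
  ∃ δ : ℝ, 0 < δ ∧ ∃ a : ℕ → ℝ, ∃ u : ℕ → ℝ → ℂ, ∃ c : ℕ → ℂ,
    Tendsto a atTop atTop ∧ (∀ k, IsWeilGroundState (a k) (u k)) ∧
    Tendsto (fun k => ∫ t, ‖c k * u k t - (xiKernel t : ℂ)‖ ^ 2 * Real.exp ((1 + δ) * |t|))
      atTop (𝓝 0)

/-- The transfer is honest: `C⁺` implies the crux as filed (statement only; proof = the two
bookkeeping facts named above). -/
def transfer_statement : Prop :=
  xiKernel_weilMellin → GroundStatesConvergeToXiKernel →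
    Theses.WeilGroundState.GroundStatesConvergeToXi

end Summit.RiemannHypothesis.RiemannHypothesis.Cruxes.GroundStatesConvergeToXi.Ideator1

end
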